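import Summits.HubbardSuperconductivity.HubbardSuperconductivity.Theses.PolyaSchurPairBoson
import Summits.AtomisticToContinuum.BoseEinsteinCondensation.Theorems.BECStronglyRayleighSectorGroundStatePerron

/-!
# Route `PolyaSchurPairBoson`, support `SectorPerronXXZ` (stmt-HubbardSuperconductivity-10294)

Perron–Frobenius in every magnetisation sector of the two-dimensional XXZ torus at ANY anisotropy
`Δ`: for `M ≥ 2` (in fact for every `M ≠ 0`) and `N ≤ M²`, the sector `S³_tot = N − M²/2` of
`xxzHamiltonian 1 (torusGraph 2 M) (−1) Δ` contains a nonzero entrywise real-nonnegative vector `ψ`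
with `H ψ = E_min(sector) ψ`, and every sector vector with that eigenvalue is a complex multiple of
`ψ`.

Proof: the `S³S³` (`Δ`) term is diagonal and real, the XY term has the off-diagonal entries `−½ ≤ 0`
of `−heisenbergHamiltonian 1 G 1` (one hop per edge) and preserves the weight, so the entries of
`xxzHamiltonian 1 G (−1) Δ` satisfy the hypotheses of the abstract stoquastic sector
Perron–Frobenius theorem `stoquastic_sector_perronFrobenius` (BEC route `BECStronglyRayleigh`,
`Theorems/BECStronglyRayleighSectorGroundStatePerron.lean`; entries from `leadPF_entries` with zero
field); the torus graph is connected (`torusGraph_connected`) and the weight sector `W = M² − N` is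
nonempty (`exists_config_weight_eq`). This is the `Δ`-general, `d = 2` twin of the BEC support
`SectorGroundStatePerron_proof` (same argument, `Δ = 0`).

Sources: H. Tasaki, *Physics and Mathematics of Quantum Many-Body Systems* (2020) §2.4;
T. Kennedy, E. H. Lieb, B. S. Shastry, PRL 61 (1988) 2582; E. H. Lieb, F. Y. Wu, Physica A 321
(2003) 1, §2. No definition is introduced.
-/

set_option linter.dupNamespace false

namespace Summit.HubbardSuperconductivity.HubbardSuperconductivity.Theorems.PolyaSchurPairBoson

open scoped BigOperators Matrix
open Literature.MathematicalPhysics.QuantumLattice Literature.Probability.LatticeModels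
open Summit.HubbardSuperconductivity.HubbardSuperconductivity.Theses.PolyaSchurPairBoson
open Summit.AtomisticToContinuum.BoseEinsteinCondensation.Theorems.BECStronglyRayleighSectorPerron
open Summit.AtomisticToContinuum.BoseEinsteinCondensation.Theorems.InsertionFieldDelocalisation.Negative

/-- **Perron–Frobenius in a magnetisation sector of the XXZ Hamiltonian on a connected graph, any
anisotropy.** For a connected finite graph `G`, any real `Δ` and any attained weight `W`, the sector
`S³_tot = |Λ|/2 − W` of `xxzHamiltonian 1 G (−1) Δ` carries a nonzero entrywise real-nonnegative
ground vector, and its sector ground vectors are unique up to scalars: the entries of the XXZ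
Hamiltonian (zero field) are real, symmetric, `−½ ≤ 0` per hop off the diagonal and zero between
different weights (`leadPF_entries`), so `stoquastic_sector_perronFrobenius` applies.
Tasaki (2020) §2.4; Lieb–Wu, Physica A 321 (2003) §2. [folklore] -/
theorem xxz_sector_perronFrobenius {Λ : Type*} [Fintype Λ] [DecidableEq Λ] (G : SimpleGraph Λ)
    [DecidableRel G.Adj] (hG : G.Connected) (Δ : ℝ) (W : ℕ)
    (hW : ∃ σ : TensorIndex Λ 2, (∑ z, (σ z : ℕ)) = W) :
    (∃ ψ ∈ spinZSector (Λ := Λ) 1 (((Fintype.card Λ * 1 : ℕ) : ℝ) / 2 - W), ψ ≠ 0 ∧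
      (∀ σ, 0 ≤ (ψ σ).re ∧ (ψ σ).im = 0) ∧
      xxzHamiltonian 1 G (-1) Δ *ᵥ ψ =
        ((lowestEnergyInSector 1 (xxzHamiltonian 1 G (-1) Δ)
          (((Fintype.card Λ * 1 : ℕ) : ℝ) / 2 - W) : ℝ) : ℂ) • ψ) ∧
    (∀ ψ φ : TensorIndex Λ 2 → ℂ,
      ψ ∈ spinZSector (Λ := Λ) 1 (((Fintype.card Λ * 1 : ℕ) : ℝ) / 2 - W) →
      φ ∈ spinZSector (Λ := Λ) 1 (((Fintype.card Λ * 1 : ℕ) : ℝ) / 2 - W) →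
      xxzHamiltonian 1 G (-1) Δ *ᵥ ψ =
        ((lowestEnergyInSector 1 (xxzHamiltonian 1 G (-1) Δ)
          (((Fintype.card Λ * 1 : ℕ) : ℝ) / 2 - W) : ℝ) : ℂ) • ψ →
      xxzHamiltonian 1 G (-1) Δ *ᵥ φ =
        ((lowestEnergyInSector 1 (xxzHamiltonian 1 G (-1) Δ)
          (((Fintype.card Λ * 1 : ℕ) : ℝ) / 2 - W) : ℝ) : ℂ) • φ →
      ψ ≠ 0 → ∃ c : ℂ, φ = c • ψ) := by
  -- entries of `xxzHamiltonian 1 G (-1) Δ = (xxzHamiltonian 1 G (-1) Δ + Σ_x 0 • S³_x)`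
  have hent :=
    Summit.AtomisticToContinuum.BoseEinsteinCondensation.Cruxes.GroundStateStability.StableConeVariationalSelection.leadPF_entries
      G Δ (fun _ => (0 : ℝ))
  simp only [Complex.ofReal_zero, zero_smul, Finset.sum_const_zero, add_zero] at hent
  obtain ⟨happ, hreal, hsymm, hoff, hwt⟩ := hent
  exact stoquastic_sector_perronFrobenius 1 G hG (xxzHamiltonian 1 G (-1) Δ)
    (fun σ τ hστ h h0 => h (neg_eq_zero.1 ((happ σ τ hστ).symm.trans h0))) hreal hsymm hoff hwt W hW

/-- **`SectorPerronXXZ` holds** (route `PolyaSchurPairBoson`, item `stmt-HubbardSuperconductivity-10294`):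
for every real `Δ`, every `M ≥ 2` and `N ≤ M²`, the sector `S³_tot = N − M²/2` (weight
`W = M² − N`) of `xxzHamiltonian 1 (torusGraph 2 M) (−1) Δ` has a nonzero entrywise real-nonnegative
ground vector, unique up to scalars among sector ground vectors — `xxz_sector_perronFrobenius` on
the connected torus graph (`torusGraph_connected`) with the sector nonempty
(`exists_config_weight_eq`, `|(ℤ/Mℤ)²| = M²`). Tasaki (2020) §2.4; Kennedy–Lieb–Shastry (1988).
[folklore] -/
theorem sectorPerronXXZ_proof : SectorPerronXXZ := by
  unfold SectorPerronXXZ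
  intro Δ M _ _ N hN
  have hW : ∃ σ : TensorIndex (TorusSite 2 M) 2, (∑ z, (σ z : ℕ)) = M ^ 2 - N :=
    exists_config_weight_eq 2 M (M ^ 2 - N) (Nat.sub_le _ _)
  obtain ⟨⟨ψ, hψK, hψ0, hψnn, hHψ⟩, huniq⟩ :=
    xxz_sector_perronFrobenius (torusGraph 2 M) (torusGraph_connected 2 M) Δ (M ^ 2 - N) hW
  have hM : ((Fintype.card (TorusSite 2 M) * 1 : ℕ) : ℝ) / 2 - ((M ^ 2 - N : ℕ) : ℝ) =
      (N : ℝ) - (M : ℝ) ^ 2 / 2 := by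
    rw [card_torusSite, Nat.cast_sub hN]
    push_cast
    ring
  rw [hM] at hψK hHψ huniq
  exact ⟨ψ, hψ0, hψnn, hψK, hHψ, fun ψ' hψ' hHψ' => huniq ψ ψ' hψK hψ' hHψ hHψ' hψ0⟩

end Summit.HubbardSuperconductivity.HubbardSuperconductivity.Theorems.PolyaSchurPairBoson
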